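/-
Copyright (c) 2026 the pub-hodgecm-mathlib formalisation cell (harness21).  Prover seat hodgecm-mathlib-LH7-p07 (g0) (re-dealt to strike line L3 `stub_N6nsDyadic` by director
s1969∕s1970 under dealer LH4-plan; β-table chair F0P3a-p01 (g37), LEDGER #15 (2) «(a) TOWER 3»), «(D-RAM) FOUR-FRAME» road of crux H413, line LH4, (β-BAL) Stage B,
β-BOARD v1: the TOWER-3 rows of the labelled-odd (β) table from the TOWER-1 rows by the coordinate swap `(0 2)` and the unit homothety `α⁻¹`.  2026-09-04.
-/
import Summits.HodgeConjecture.HodgeConjecture.Theorems.F0P3cDyRamLabelledOddSwapEngine           -- ★ p861439 (LH4-p18 (g0)): `finsum_stratum_shell_labelledOdd_div_relIndex_perm`, `labelledOddCount_eq`; brings ★ §P `exists_gl_rescale_swap02`, `isElementDatum_rescale`, `stratum_eq_of_coe_eq_smul`, `mem_mapGL_perm_iff`, `coe_conj_eq_diagonal`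
import Summits.HodgeConjecture.HodgeConjecture.Theorems.F0P3cDyRamProfileCountCentralRescaling   -- ★ (F0P3c): `latticeInLevel_iff_of_eq_smul`, `latticeInLevel_sq_iff_of_eq_smul`, `sub_one_mulVec_mem_of_mapGL_eq`, `v_sub_le_one_iff_of_le`
import Summits.HodgeConjecture.HodgeConjecture.Theorems.F0P3cDyRamFrameEltOneSlotLabel           -- ★ (LH4): `valueSetMod_smul_xPlus_congr`
import Summits.HodgeConjecture.HodgeConjecture.Theorems.F0P3cDyRamCleanLabelCountDiagonalModel   -- ★ (LH4): `setOf_value_smul_eq_iff`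
import Summits.HodgeConjecture.HodgeConjecture.Theorems.F0P3cDyRamDiagonalSelfDualFibre          -- ★ (F0P3c): `pairing_diagonal`
import Summits.HodgeConjecture.HodgeConjecture.Theorems.F0P3cDyRamStageOneBDerivedDefs          -- ★ DEFS: `n0DerivedOfRecord`, `mcOfRecord_le_n0DerivedOfRecord` (and ★ `mstarOfRecord_le_mcOfRecord`)
import Literature.NumberTheory.LocalFields.WildQuadraticDatumRefSkewScalar                       -- ★: `v_refSkewScalar`
import HarnessLib

/-!
# Crux `H413`, line LH4 «(D-RAM) FOUR-FRAME» — (β-BAL) Stage B, β-BOARD v1: THE TOWER-3 ROWS OF THE LABELLED-ODD TABLE ARE THE TOWER-1 ROWS AT THE RESCALED DATUM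
# `(α⁻¹, β·α⁻¹; n₃, n₂, n₁)`, SLOT `(0 2)·i` — the `(0 2)`-swap engine for the common shape, and the TOWER-3 FOOT LINE `hF₃` from the TOWER-1 FOOT LINE

Cell `hodgecm-mathlib` (D-0151), FLOOR 0, crux item H413 = `stmt-HodgeConjecture-24833`, route `HCCMUnconditional`; squad F0∕P3c∕LH4 (this seat re-dealt from F0∕P3c∕LH7).
THEOREMS ONLY (no `def`, no instance, no notation, no `sorry`, default heartbeats); ★-only imports; lane `--supports stmt-HodgeConjecture-24833 --as helper` (count-neutral);
pays NO row, states NO law.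
WHY (β-table chair F0P3a-p01 (g37), LEDGER #15 (2), 2026-09-04: «LH7-p07 owns `hF₃` = THE FOOT LINE OF TOWER 3», the binder `∀ ρ s, 1 ≤ ρ → 1 ≤ s → 2 ∣ s → n₃ = n₂ + s → ∀ i,
Σᶠ_{M ∈ stratum(T, (2ρ+s, 2ρ+s, 2ρ)) ∩ clean shell} m^Λ_i(M) ∕ [𝒰 : N(S̃ M)] = 0` of the rest assembly `restSum_eq_of_rows`).  Every entry of the (β) table has the COMMON SHAPE
`Σᶠ_{M ∈ stratum σ ϖ T a ∧ shell M} labelledOddCount σ ϖ tv i (valueClassLabel σ ϖ (α−1) (β−1) m d) M ∕ [𝒰 : N(S̃(M))]` (shell = levels `ℓ, ¬ℓ′` of `X = diag(α−1, β−1, 0) = T − 1`, one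
level `mc` of `X²`); ★ p861439 (LH4-p18 (g0)) is its `(0 1)`-swap engine (G₁ ↔ G₂, G₃ ↔ G₃).  The `(0 2)`-swap carries `T = diag(α, β, 1)` to `diag(1, β, α)`, NOT of the normalised
form `diag(·, ·, 1)`; the unit homothety `α⁻¹` repairs it: `T″ = α⁻¹·diag(1, β, α) = diag(α⁻¹, βα⁻¹, 1)` is the torus element of the RESCALED DATUM `(α⁻¹, βα⁻¹)`, an element datum
with depths `(n₃, n₂, n₁)` (★ §P `isElementDatum_rescale`, `exists_gl_rescale_swap02`), and `T″·M = diag(1,β,α)·M` for every lattice (★ `stratum_eq_of_coe_eq_smul`) — ★ for the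
κ-weighted and unlabelled counts (★ §P `…_swap02_of`, `…_G3_of_G1`).  For the LABELLED-ODD shape two more tokens must move, and they do in the range of the record (all levels `≤ N₀ ≤ n₂`):
* SHELL TOKENS (★ `F0P3cDyRamProfileCountCentralRescaling`, verbatim): `T″ − 1 = α⁻¹·(diag(1,β,α) − 1) + (α⁻¹ − 1)·1`, `|α⁻¹ − 1| = |ϖ|^{n₂}`: levels `ℓ, ℓ′` and the square
  level `mc` agree (`latticeInLevel_iff_of_eq_smul`, `latticeInLevel_sq_iff_of_eq_smul`).
* THE VALUE-CLASS LABEL (§2, the one new point): the transported label form is `D₂(α−1)N(y₂) + D₁(β−1)N(y₁) = α·[D₀(α⁻¹−1)N(y₀) + D₁(βα⁻¹−1)N(y₁)] + (α−1)·⟨y, y⟩_D` with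
  `|⟨y, y⟩_D| ≤ 1` for `y ∈ M` and EVERY form `D` of every polarisation class of `M` (§1: `D = D₁·N(u)`, `u ∈ S̃(M)`, `⟨y,y⟩_D = ⟨uy, uy⟩_{D₁}`, `uy ∈ M ⊆ M^♯`, ★
  `v_pairing_self_le_one`); with `|α − 1| ≤ |ϖ|^m` the thickened value sets are `α`-multiples of each other and the reference set is blind to the unit `α⁻¹ ≡ 1 (ϖ^m)` (★
  `setOf_value_smul_eq_iff`, ★ `valueSetMod_smul_xPlus_congr`): `valueClassLabel (α−1) (β−1) m d (P·M) (D ∘ (0 2)) ↔ valueClassLabel (α⁻¹−1) (βα⁻¹−1) m d M D`.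
WHAT IS PROVED.  §1 `mulVec_diagonal_mem_of_mem_unitStabilizer`, **`v_gram_le_one_of_mem_polarisationNormClasses`**, `classLabelSign_congr`, **`labelledOddCount_congr`** (a label may be
replaced by one equivalent on every form of every class) · §2 `binaryNormForm_swap02_eq`, **`valueClassLabel_mapGL_swap02_iff`** · §3 matrix letters, **`setOf_stratum_shell_swap02_eq`**
(the transported index SET at `diag(1,β,α)` is the common-shape index set at `T″`) · §4 HEADS: **`finsum_stratum_shell_labelledOdd_div_relIndex_swap02`** (ANY axis vector and type; levels
`ℓ, ℓ′, mc, m ≤ N₀`; any `T″` with matrix `diag(α⁻¹, βα⁻¹, 1)`): `Σᶠ_{stratum(T,(a₀,a₁,a₂)) ∩ shell(α,β)} m^{Λ(α−1,β−1)}_i ∕ idx = Σᶠ_{stratum(T″,(a₂,a₁,a₀)) ∩ shell(α⁻¹,βα⁻¹)}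
m^{Λ(α⁻¹−1,βα⁻¹−1)}_{(0 2)i} ∕ idx`; the ADAPTER **`…_swap02_of`** (a head of any shape `F` under a side condition `Hyp` with a witness `w`, as ★ p861439's `…_swap01_of`): value
`F α⁻¹ (βα⁻¹) n₃ n₂ n₁ w ((0 2) i)`; in the letters of the record (`ℓ = d % 2`, `ℓ′ = d % 2 + 1`, `mc = mcOfRecord d`, `m* = mstarOfRecord d`, `N₀ = n0DerivedOfRecord d`, type `0`)
**`finsum_stratum_G3_shell_labelledOdd_div_relIndex_eq_of_G1`** (every G₃ row — e.g. the κ-locus row `hR6₃` — is the G₁ row at `(α⁻¹, βα⁻¹; n₃, n₂, n₁)`, slot `(0 2) i`) and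
**`finsum_stratum_G3_shell_labelledOdd_div_relIndex_eq_zero_of_foot_of_G1`** = the chair's binder `hF₃` VERBATIM from the tower-1 foot line quantified over the element datum
(`n₁′ = n₂′ + s`; LH7-p05 (g0)'s ★ p861363 tube∕top and window theorems are so quantified).
HONEST LABEL.  Count-neutral transport; sums nothing to a number; `hF₃` is discharged only RELATIVE to the tower-1 foot line; rows∕`hRest`∕(β-BAL)∕(β)∕T₊ OPEN; `HC_CM` is proved
only modulo the 7 printed citations (2 remaining named inputs: hLiu418 = `stmt-HodgeConjecture-24832`, h413 = `stmt-HodgeConjecture-24833`) until rung 0 closes.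

## References
* [Kottwitz1986BaseChangeUnits] R. E. Kottwitz, *Base change for unit elements of Hecke algebras*, Compositio Math. 60 (1986), §1 pp. 240–241 (signed lattice counts modulo the
  diagonal torus; symmetry in the coordinates of the split torus; central modifications).
* [Rogawski1990] J. D. Rogawski, *Automorphic Representations of Unitary Groups in Three Variables*, Ann. of Math. Stud. 123 (1990), §4.9 Prop. 4.9.1 (a)(b) p. 55, Lemma 4.9.3.
* [BruhatTits1972] F. Bruhat, J. Tits, *Groupes réductifs sur un corps local I*, Publ. Math. IHÉS 41 (1972), §10 (homotheties act trivially on the building).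
* [LanglandsShelstad1987] R. P. Langlands, D. Shelstad, *On the definition of transfer factors*, Math. Ann. 278 (1987), §3.
* [Jacobowitz1962] R. Jacobowitz, *Hermitian forms over local fields*, Amer. J. Math. 84 (1962), §7 (a unimodular lattice lies in its dual).
-/

set_option autoImplicit false

noncomputable section

namespace Summit.HodgeConjecture.HodgeConjecture.Cruxes.H413.F0P3cDyRamLabelledOddTowerThreeOfTowerOne

open Matrix
open Literature.NumberTheory.Automorphic Literature.NumberTheory.Automorphic.HermitianLattice
open Literature.NumberTheory.Automorphic.UnitaryLatticeTree Literature.NumberTheory.Automorphic.UnitaryThreeFourFrame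
open Literature.NumberTheory.LocalFields.WildQuadraticDatum (v_refSkewScalar)
open Summit.HodgeConjecture.HodgeConjecture.Cruxes.H413.F0P3cDyRamDiagonalTorusDefs
open Summit.HodgeConjecture.HodgeConjecture.Cruxes.H413.F0P3cDyRamDiagonalStrataDefs
open Summit.HodgeConjecture.HodgeConjecture.Cruxes.H413.F0P3cDyRamDiagonalPermutation
open Summit.HodgeConjecture.HodgeConjecture.Cruxes.H413.F0P3cDyRamDiagonalKappaPermutation (exists_gl_rescale_swap02)
open Summit.HodgeConjecture.HodgeConjecture.Cruxes.H413.F0P3cDyRamDiagonalSelfDualFibre (pairing_diagonal)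
open Summit.HodgeConjecture.HodgeConjecture.Cruxes.H413.F0P3cDyRamFourFrameCensusDefs
open Summit.HodgeConjecture.HodgeConjecture.Cruxes.H413.F0P3cDyRamFourFramePieces (valueSetMod xPlus mstarOfRecord)
open Summit.HodgeConjecture.HodgeConjecture.Cruxes.H413.F0P3cDyRamStageOneBDefs (mcOfRecord mstarOfRecord_le_mcOfRecord)
open Summit.HodgeConjecture.HodgeConjecture.Cruxes.H413.F0P3cDyRamStageOneBDerivedDefs (n0DerivedOfRecord mcOfRecord_le_n0DerivedOfRecord)
open Summit.HodgeConjecture.HodgeConjecture.Cruxes.H413.F0P3cDyRamProfileCountCentralRescaling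
  (latticeInLevel_iff_of_eq_smul latticeInLevel_sq_iff_of_eq_smul sub_one_mulVec_mem_of_mapGL_eq v_sub_le_one_iff_of_le)
open Summit.HodgeConjecture.HodgeConjecture.Cruxes.H413.F0P3cDyRamFrameEltOneSlotLabel (valueSetMod_smul_xPlus_congr)
open Summit.HodgeConjecture.HodgeConjecture.Cruxes.H413.F0P3cDyRamCleanLabelCountDiagonalModel (setOf_value_smul_eq_iff)
open Summit.HodgeConjecture.HodgeConjecture.Cruxes.H413.F0P3cDyRamLabelledOddCountDefs
open Summit.HodgeConjecture.HodgeConjecture.Cruxes.H413.F0P3cDyRamLabelledOddSwapEngine (finsum_stratum_shell_labelledOdd_div_relIndex_perm)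
open scoped Valued WithZero Matrix MatrixGroups

variable {K : Type} [Field K] [Valued K ℤᵐ⁰]

/-! ## §1  Every form of every polarisation class has an integral Gram value on the lattice; labels equivalent class-wise give the same labelled odd count -/

/-- `diag(u)·y ∈ M` for `y ∈ M` and `u ∈ S̃(M)`. [cite: Kottwitz1986BaseChangeUnits, §1 pp. 240–241] -/
theorem mulVec_diagonal_mem_of_mem_unitStabilizer {M : Submodule 𝒪[K] (Fin 3 → K)} {u : Fin 3 → Kˣ} (hu : u ∈ unitStabilizer M)
    {y : Fin 3 → K} (hy : y ∈ M) : (Matrix.diagonal fun j => (u j : K)) *ᵥ y ∈ M := by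
  have hfix : mapGL (diagGLUnits u) M = M := ((mem_unitStabilizer_iff M u).1 hu).1
  have h1 : ((Matrix.toLin' ((diagGLUnits u : GL (Fin 3) K) : Matrix (Fin 3) (Fin 3) K)).restrictScalars 𝒪[K]) y ∈ mapGL (diagGLUnits u) M := Submodule.mem_map_of_mem hy
  rwa [hfix, LinearMap.restrictScalars_apply, Matrix.toLin'_apply, coe_diagGLUnits] at h1

/-- **EVERY FORM OF EVERY POLARISATION CLASS HAS AN INTEGRAL GRAM VALUE ON THE LATTICE**: for `C ∈ polarisationNormClasses σ ϖ tv M`, `D ∈ C` and `y ∈ M`,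
`|Σ_j σ(y_j)·D_j·y_j| ≤ 1` — `D = D₁·N(u)` with `u ∈ S̃(M)` and `D₁` a polarisation, so the value is `⟨uy, uy⟩_{D₁}` at `uy ∈ M ⊆ M^♯` (★ `v_pairing_self_le_one`).
[cite: Jacobowitz1962, §7] [cite: Kottwitz1986BaseChangeUnits, §1 pp. 240–241] -/
theorem v_gram_le_one_of_mem_polarisationNormClasses {σ : K →+* K} (hvσ : ∀ a, Valued.v (σ a) = Valued.v a) {ϖ : K} {tv : ℕ}
    {M : Submodule 𝒪[K] (Fin 3 → K)} {C : Set (Fin 3 → K)} (hC : C ∈ polarisationNormClasses σ ϖ tv M) {D : Fin 3 → K} (hD : D ∈ C)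
    {y : Fin 3 → K} (hy : y ∈ M) : Valued.v (∑ j, σ (y j) * D j * y j) ≤ 1 := by
  obtain ⟨D₁, ⟨-, hD₁M⟩, rfl⟩ := (mem_polarisationNormClasses_iff σ ϖ tv M C).1 hC
  obtain ⟨n, hn, hDn⟩ := hD
  obtain ⟨u, hu, rfl⟩ := Subgroup.mem_map.1 hn
  have hmem := mulVec_diagonal_mem_of_mem_unitStabilizer hu hy
  have hle := v_pairing_self_le_one hvσ hD₁M hmem
  rw [pairing_diagonal] at hle
  have e : ∑ j, σ (y j) * D j * y j = ∑ j, σ (((Matrix.diagonal fun j => (u j : K)) *ᵥ y) j) * D₁ j * ((Matrix.diagonal fun j => (u j : K)) *ᵥ y) j := by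
    refine Finset.sum_congr rfl fun j _ => ?_
    rw [Matrix.mulVec_diagonal, hDn j, unitNormMap_apply, map_mul]
    ring
  rw [e]
  exact hle

omit [Valued K ℤᵐ⁰] in
/-- The signed label of a class only reads the label on the forms of the class. [cite: LanglandsShelstad1987, §3] -/
theorem classLabelSign_congr (σ : K →+* K) (i : Fin 3) {P P' : (Fin 3 → K) → Prop} {C : Set (Fin 3 → K)} (h : ∀ D ∈ C, (P D ↔ P' D)) :
    classLabelSign σ i P C = classLabelSign σ i P' C := by
  have h1 : (∀ D ∈ C, P D ∧ normSign σ (D i) = 1) ↔ (∀ D ∈ C, P' D ∧ normSign σ (D i) = 1) := forall₂_congr fun D hD => by rw [h D hD]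
  have h2 : (∀ D ∈ C, P D ∧ normSign σ (D i) = -1) ↔ (∀ D ∈ C, P' D ∧ normSign σ (D i) = -1) := forall₂_congr fun D hD => by rw [h D hD]
  by_cases ha : ∀ D ∈ C, P D ∧ normSign σ (D i) = 1
  · rw [classLabelSign, classLabelSign, if_pos ha, if_pos (h1.1 ha)]
  · by_cases hb : ∀ D ∈ C, P D ∧ normSign σ (D i) = -1
    · rw [classLabelSign, classLabelSign, if_neg ha, if_neg (fun h' => ha (h1.2 h')), if_pos hb, if_pos (h2.1 hb)]
    · rw [classLabelSign, classLabelSign, if_neg ha, if_neg (fun h' => ha (h1.2 h')), if_neg hb, if_neg (fun h' => hb (h2.2 h'))]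

/-- **A LABEL MAY BE REPLACED BY ONE EQUIVALENT TO IT ON EVERY FORM OF EVERY POLARISATION CLASS** without changing `labelledOddCount`. [cite: LanglandsShelstad1987, §3]
[cite: Kottwitz1986BaseChangeUnits, §1 pp. 240–241] -/
theorem labelledOddCount_congr (σ : K →+* K) (ϖ : K) (tv : ℕ) (i : Fin 3) {Λ Λ' : Submodule 𝒪[K] (Fin 3 → K) → (Fin 3 → K) → Prop}
    {M : Submodule 𝒪[K] (Fin 3 → K)} (h : ∀ C ∈ polarisationNormClasses σ ϖ tv M, ∀ D ∈ C, (Λ M D ↔ Λ' M D)) :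
    labelledOddCount σ ϖ tv i Λ M = labelledOddCount σ ϖ tv i Λ' M := by
  rw [labelledOddCount_eq, labelledOddCount_eq]
  exact finsum_mem_congr rfl fun C hC => classLabelSign_congr σ i (h C hC)

/-! ## §2  The value-class label under the swap `(0 2)` and the unit homothety `α⁻¹` -/

omit [Valued K ℤᵐ⁰] in
/-- The transported binary norm form: `D₂(α−1)N(y₂) + D₁(β−1)N(y₁) = α·[D₀(α⁻¹−1)N(y₀) + D₁(βα⁻¹−1)N(y₁)] + (α−1)·Σ_j σ(y_j)D_j y_j` (`α ≠ 0`).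
[cite: Rogawski1990, §4.9 Prop. 4.9.1 (b) p. 55] -/
theorem binaryNormForm_swap02_eq (σ : K →+* K) {α : K} (hα0 : α ≠ 0) (β : K) (D y : Fin 3 → K) :
    D 2 * (α - 1) * (y 2 * σ (y 2)) + D 1 * (β - 1) * (y 1 * σ (y 1)) =
      α * (D 0 * (α⁻¹ - 1) * (y 0 * σ (y 0)) + D 1 * (β * α⁻¹ - 1) * (y 1 * σ (y 1))) + (α - 1) * ∑ j, σ (y j) * D j * y j := by
  rw [Fin.sum_univ_three]
  have e1 : α * (α⁻¹ - 1) = 1 - α := by rw [mul_sub, mul_inv_cancel₀ hα0, mul_one]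
  have e2 : α * (β * α⁻¹ - 1) = β - α := by rw [mul_sub, mul_one, mul_comm β, ← mul_assoc, mul_inv_cancel₀ hα0, one_mul]
  calc D 2 * (α - 1) * (y 2 * σ (y 2)) + D 1 * (β - 1) * (y 1 * σ (y 1)) = (α * (α⁻¹ - 1)) * (D 0 * (y 0 * σ (y 0))) + (α * (β * α⁻¹ - 1)) * (D 1 * (y 1 * σ (y 1))) +
        (α - 1) * (σ (y 0) * D 0 * y 0 + σ (y 1) * D 1 * y 1 + σ (y 2) * D 2 * y 2) := by rw [e1, e2]; ring
    _ = _ := by ring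

/-- **THE VALUE-CLASS LABEL UNDER `(0 2)` AND THE HOMOTHETY `α⁻¹`**: for a unit `α` with `|α − 1| ≤ |ϖ^m|`, an integral reference scalar `t₊ = (ϖ − σϖ)·(ϖσϖ)^{−(d − d%2)∕2}`, `P` the matrix
of `(0 2)`, and a form `D` whose Gram values on `M` are integral (§1: every form of every polarisation class),
`valueClassLabel σ ϖ (α−1) (β−1) m d (P·M) (D ∘ (0 2)) ↔ valueClassLabel σ ϖ (α⁻¹−1) (βα⁻¹−1) m d M D`. [cite: Rogawski1990, §4.9 Prop. 4.9.1 (b) p. 55, Lemma 4.9.3]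
[cite: BruhatTits1972, §10] -/
theorem valueClassLabel_mapGL_swap02_iff {σ : K →+* K} (hvσ : ∀ a, Valued.v (σ a) = Valued.v a) {ϖ : K} (hϖ0 : ϖ ≠ 0) {d : ℕ}
    (htp : Valued.v ((ϖ - σ ϖ) * ((ϖ * σ ϖ) ^ ((d - d % 2) / 2))⁻¹) ≤ 1) {α : K} (hα : Valued.v α = 1) {m : ℕ}
    (hαm : Valued.v (α - 1) ≤ Valued.v (ϖ ^ m)) (β : K) (P : GL (Fin 3) K) (hP : (P : Matrix (Fin 3) (Fin 3) K) = (Equiv.swap (0 : Fin 3) 2).permMatrix K)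
    {M : Submodule 𝒪[K] (Fin 3 → K)} {D : Fin 3 → K} (hG : ∀ y ∈ M, Valued.v (∑ j, σ (y j) * D j * y j) ≤ 1) :
    valueClassLabel σ ϖ (α - 1) (β - 1) m d (mapGL P M) (D ∘ ⇑(Equiv.swap (0 : Fin 3) 2)) ↔ valueClassLabel σ ϖ (α⁻¹ - 1) (β * α⁻¹ - 1) m d M D := by
  have hα0 : α ≠ 0 := fun h => by rw [h, map_zero] at hα; exact zero_ne_one hα
  have hc : (ϖ ^ m : K) ≠ 0 := pow_ne_zero m hϖ0
  have hvc : Valued.v (ϖ ^ m) ≠ 0 := (Valuation.ne_zero_iff _).2 hc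
  -- the transported value set is the `α`-multiple set of the rescaled binary form
  have hset : {v : K | ∃ y ∈ mapGL P M, Valued.v ((ϖ ^ m)⁻¹ * (v -
      ((D ∘ ⇑(Equiv.swap (0 : Fin 3) 2)) 0 * (α - 1) * (y 0 * σ (y 0)) + (D ∘ ⇑(Equiv.swap (0 : Fin 3) 2)) 1 * (β - 1) * (y 1 * σ (y 1))))) ≤ 1} =
      {v : K | ∃ y ∈ M, Valued.v ((ϖ ^ m)⁻¹ * (v - α * (D 0 * (α⁻¹ - 1) * (y 0 * σ (y 0)) + D 1 * (β * α⁻¹ - 1) * (y 1 * σ (y 1))))) ≤ 1} := by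
    have hs0 : (D ∘ ⇑(Equiv.swap (0 : Fin 3) 2)) 0 = D 2 := by simp
    have hs1 : (D ∘ ⇑(Equiv.swap (0 : Fin 3) 2)) 1 = D 1 := by simp [Equiv.swap_apply_of_ne_of_ne (show (1 : Fin 3) ≠ 0 by decide) (show (1 : Fin 3) ≠ 2 by decide)]
    -- the key: for `y′ ∈ M` the transported form at `y = y′ ∘ (0 2)` differs from `α·(rescaled form at y′)` by `(α − 1)·(integral)`
    have hkey : ∀ y' ∈ M, ∀ v : K,
        Valued.v ((ϖ ^ m)⁻¹ * (v - (D 2 * (α - 1) * (y' 2 * σ (y' 2)) + D 1 * (β - 1) * (y' 1 * σ (y' 1))))) ≤ 1 ↔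
          Valued.v ((ϖ ^ m)⁻¹ * (v - α * (D 0 * (α⁻¹ - 1) * (y' 0 * σ (y' 0)) + D 1 * (β * α⁻¹ - 1) * (y' 1 * σ (y' 1))))) ≤ 1 := by
      intro y' hy' v
      have hδ : Valued.v ((ϖ ^ m)⁻¹ * ((α - 1) * ∑ j, σ (y' j) * D j * y' j)) ≤ 1 := by
        rw [map_mul, map_mul, map_inv₀]
        calc (Valued.v (ϖ ^ m))⁻¹ * (Valued.v (α - 1) * Valued.v (∑ j, σ (y' j) * D j * y' j))
            ≤ (Valued.v (ϖ ^ m))⁻¹ * (Valued.v (ϖ ^ m) * 1) := mul_le_mul' le_rfl (mul_le_mul' hαm (hG y' hy'))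
          _ = 1 := by rw [mul_one, inv_mul_cancel₀ hvc]
      rw [binaryNormForm_swap02_eq σ hα0 β D y', show ∀ a b : K, (ϖ ^ m)⁻¹ * (v - (a + b)) = (ϖ ^ m)⁻¹ * (v - a) - (ϖ ^ m)⁻¹ * b from fun a b => by ring]
      exact v_sub_le_one_iff_of_le hδ
    ext v
    simp only [Set.mem_setOf_eq]
    constructor
    · rintro ⟨y, hy, hv⟩
      have hy' : y ∘ ⇑(Equiv.swap (0 : Fin 3) 2).symm ∈ M := (mem_mapGL_perm_iff P hP M y).1 hy
      refine ⟨y ∘ ⇑(Equiv.swap (0 : Fin 3) 2).symm, hy', ?_⟩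
      have e2 : (y ∘ ⇑(Equiv.swap (0 : Fin 3) 2).symm) 2 = y 0 := by simp [Equiv.symm_swap]
      have e1 : (y ∘ ⇑(Equiv.swap (0 : Fin 3) 2).symm) 1 = y 1 := by
        simp [Equiv.symm_swap, Equiv.swap_apply_of_ne_of_ne (show (1 : Fin 3) ≠ 0 by decide) (show (1 : Fin 3) ≠ 2 by decide)]
      rw [← hkey _ hy' v, e2, e1]
      rwa [hs0, hs1] at hv
    · rintro ⟨y', hy', hv⟩
      refine ⟨y' ∘ ⇑(Equiv.swap (0 : Fin 3) 2), (mem_mapGL_perm_iff P hP M _).2 ?_, ?_⟩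
      · have e : (y' ∘ ⇑(Equiv.swap (0 : Fin 3) 2)) ∘ ⇑(Equiv.swap (0 : Fin 3) 2).symm = y' := by ext j; simp
        rw [e]; exact hy'
      · have e0 : (y' ∘ ⇑(Equiv.swap (0 : Fin 3) 2)) 0 = y' 2 := by simp
        have e1 : (y' ∘ ⇑(Equiv.swap (0 : Fin 3) 2)) 1 = y' 1 := by simp [Equiv.swap_apply_of_ne_of_ne (show (1 : Fin 3) ≠ 0 by decide) (show (1 : Fin 3) ≠ 2 by decide)]
        rw [hs0, hs1, e0, e1]
        exact (hkey y' hy' v).2 hv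
  -- the reference set is blind to the unit `α⁻¹ ≡ 1 (ϖ^m)`
  have hαinv : Valued.v (α⁻¹ * 1 - 1) ≤ Valued.v (ϖ ^ m) := by
    rw [mul_one, show α⁻¹ - 1 = -(α⁻¹ * (α - 1)) by rw [mul_sub, inv_mul_cancel₀ hα0, mul_one, neg_sub], Valuation.map_neg, map_mul, map_inv₀, hα,
      inv_one, one_mul]
    exact hαm
  have hee : Valued.v ((ϖ ^ m)⁻¹ * ((α⁻¹ * 1 - 1) * ((ϖ - σ ϖ) * ((ϖ * σ ϖ) ^ ((d - d % 2) / 2))⁻¹))) ≤ 1 := by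
    rw [map_mul, map_mul, map_inv₀]
    calc (Valued.v (ϖ ^ m))⁻¹ * (Valued.v (α⁻¹ * 1 - 1) * Valued.v ((ϖ - σ ϖ) * ((ϖ * σ ϖ) ^ ((d - d % 2) / 2))⁻¹))
        ≤ (Valued.v (ϖ ^ m))⁻¹ * (Valued.v (ϖ ^ m) * 1) := mul_le_mul' le_rfl (mul_le_mul' hαinv htp)
      _ = 1 := by rw [mul_one, inv_mul_cancel₀ hvc]
  rw [valueClassLabel_iff, valueClassLabel_iff, hset, ← one_smul K (xPlus σ ϖ d),
    setOf_value_smul_eq_iff σ ϖ d m 1 hα M (fun y => D 0 * (α⁻¹ - 1) * (y 0 * σ (y 0)) + D 1 * (β * α⁻¹ - 1) * (y 1 * σ (y 1))),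
    valueSetMod_smul_xPlus_congr hvσ ϖ d m hee]

/-! ## §3  Matrix letters and the transported index set -/

omit [Valued K ℤᵐ⁰] in
/-- `diag(a, b, c) − 1 = diag(a − 1, b − 1, c − 1)`. [cite: Kottwitz1986BaseChangeUnits, §1 pp. 240–241] -/
theorem diagonal_sub_one_eq (a b c : K) :
    (Matrix.diagonal ![a, b, c] : Matrix (Fin 3) (Fin 3) K) - 1 = Matrix.diagonal ![a - 1, b - 1, c - 1] := by
  rw [← Matrix.diagonal_one, Matrix.diagonal_sub]; congr 1; ext j; fin_cases j <;> rfl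

omit [Valued K ℤᵐ⁰] in
/-- `diag(a, b, c)·diag(a, b, c) = diag(a², b², c²)`. [cite: Kottwitz1986BaseChangeUnits, §1 pp. 240–241] -/
theorem diagonal_mul_diagonal_eq (a b c : K) :
    (Matrix.diagonal ![a, b, c] : Matrix (Fin 3) (Fin 3) K) * Matrix.diagonal ![a, b, c] = Matrix.diagonal ![a * a, b * b, c * c] := by
  rw [Matrix.diagonal_mul_diagonal]; congr 1; ext j; fin_cases j <;> rfl

omit [Valued K ℤᵐ⁰] in
/-- `α⁻¹·diag(1, β, α) = diag(α⁻¹, βα⁻¹, 1)` (`α ≠ 0`). [cite: Kottwitz1986BaseChangeUnits, §1 pp. 240–241] -/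
theorem smul_diagonal_swap02_eq {α : K} (hα0 : α ≠ 0) (β : K) :
    α⁻¹ • (Matrix.diagonal ![1, β, α] : Matrix (Fin 3) (Fin 3) K) = Matrix.diagonal ![α⁻¹, β * α⁻¹, 1] := by
  rw [← Matrix.diagonal_smul]; congr 1; ext j; fin_cases j
  · simp
  · simp [mul_comm]
  · simp [inv_mul_cancel₀ hα0]

/-- **THE TRANSPORTED INDEX SET**: at a `GL`-element `T′` with matrix `diag(1, β, α)` and ANY `T″` with matrix `diag(α⁻¹, βα⁻¹, 1)`, `|α| = 1`, `|α − 1| ≤ |ϖ|^ℓ, |ϖ|^{ℓ′}, |ϖ|^{mc}`: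
`{M ∈ stratum(T′, a) : shell of diag(0, β−1, α−1) at (ℓ, ¬ℓ′; squares mc)} = {M ∈ stratum(T″, a) : shell of diag(α⁻¹−1, βα⁻¹−1, 0)}` (★ `stratum_eq_of_coe_eq_smul`; ★
`latticeInLevel_iff_of_eq_smul`, ★ `latticeInLevel_sq_iff_of_eq_smul` at `T″ = α⁻¹·T′`). [cite: BruhatTits1972, §10] [cite: Kottwitz1986BaseChangeUnits, §1 pp. 240–241] -/
theorem setOf_stratum_shell_swap02_eq (σ : K →+* K) {ϖ : K} (hϖ0 : ϖ ≠ 0) (hϖ1 : Valued.v ϖ ≤ 1) {α : K} (hα : Valued.v α = 1) (β : K)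
    {ℓ ℓ' mc : ℕ} (hℓ : Valued.v (α - 1) ≤ Valued.v ϖ ^ ℓ) (hℓ' : Valued.v (α - 1) ≤ Valued.v ϖ ^ ℓ') (hmc : Valued.v (α - 1) ≤ Valued.v ϖ ^ mc)
    (T' T'' : GL (Fin 3) K) (hT' : (T' : Matrix (Fin 3) (Fin 3) K) = Matrix.diagonal ![1, β, α])
    (hT'' : (T'' : Matrix (Fin 3) (Fin 3) K) = Matrix.diagonal ![α⁻¹, β * α⁻¹, 1]) (a : Fin 3 → ℕ) :
    {M : Submodule 𝒪[K] (Fin 3 → K) | M ∈ stratum σ ϖ T' a ∧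
        (LatticeInLevel ϖ ℓ (Matrix.diagonal ![0, β - 1, α - 1]) M ∧ ¬ LatticeInLevel ϖ ℓ' (Matrix.diagonal ![0, β - 1, α - 1]) M ∧
          LatticeInLevel ϖ mc (Matrix.diagonal ![0 * 0, (β - 1) * (β - 1), (α - 1) * (α - 1)]) M)} =
      {M : Submodule 𝒪[K] (Fin 3 → K) | M ∈ stratum σ ϖ T'' a ∧
        (LatticeInLevel ϖ ℓ (Matrix.diagonal ![α⁻¹ - 1, β * α⁻¹ - 1, 0]) M ∧ ¬ LatticeInLevel ϖ ℓ' (Matrix.diagonal ![α⁻¹ - 1, β * α⁻¹ - 1, 0]) M ∧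
          LatticeInLevel ϖ mc (Matrix.diagonal ![(α⁻¹ - 1) * (α⁻¹ - 1), (β * α⁻¹ - 1) * (β * α⁻¹ - 1), 0 * 0]) M)} := by
  have hα0 : α ≠ 0 := fun h => by rw [h, map_zero] at hα; exact zero_ne_one hα
  have hz1 : Valued.v α⁻¹ = 1 := by rw [map_inv₀, hα, inv_one]
  have hzsub : Valued.v (α⁻¹ - 1) = Valued.v (α - 1) := by
    rw [show α⁻¹ - 1 = -(α⁻¹ * (α - 1)) by rw [mul_sub, inv_mul_cancel₀ hα0, mul_one, neg_sub], Valuation.map_neg, map_mul, hz1, one_mul]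
  have hTT : (T'' : Matrix (Fin 3) (Fin 3) K) = α⁻¹ • (T' : Matrix (Fin 3) (Fin 3) K) := by rw [hT'', hT', smul_diagonal_swap02_eq hα0]
  -- the token matrices as `T − 1` and its square
  have hX' : Matrix.diagonal ![0, β - 1, α - 1] = (T' : Matrix (Fin 3) (Fin 3) K) - 1 := by rw [hT', diagonal_sub_one_eq, sub_self]
  have hX'' : Matrix.diagonal ![α⁻¹ - 1, β * α⁻¹ - 1, 0] = (T'' : Matrix (Fin 3) (Fin 3) K) - 1 := by rw [hT'', diagonal_sub_one_eq, sub_self]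
  have hX'2 : Matrix.diagonal ![0 * 0, (β - 1) * (β - 1), (α - 1) * (α - 1)] = ((T' : Matrix (Fin 3) (Fin 3) K) - 1) * ((T' : Matrix (Fin 3) (Fin 3) K) - 1) := by rw [← hX', diagonal_mul_diagonal_eq]
  have hX''2 : Matrix.diagonal ![(α⁻¹ - 1) * (α⁻¹ - 1), (β * α⁻¹ - 1) * (β * α⁻¹ - 1), 0 * 0] = ((T'' : Matrix (Fin 3) (Fin 3) K) - 1) * ((T'' : Matrix (Fin 3) (Fin 3) K) - 1) := by
    rw [← hX'', diagonal_mul_diagonal_eq]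
  have hstr : stratum σ ϖ T'' a = stratum σ ϖ T' a := stratum_eq_of_coe_eq_smul σ ϖ hz1 hTT a
  rw [hX', hX'', hX'2, hX''2]
  ext M
  simp only [Set.mem_setOf_eq]
  rw [hstr]
  refine and_congr_right fun hM => ?_
  have hfix : mapGL T' M = M := ((mem_stratum_iff σ ϖ T' a M).1 hM).1.2.1
  have hAM : ∀ x ∈ M, ((T' : Matrix (Fin 3) (Fin 3) K) - 1) *ᵥ x ∈ M := fun x hx => sub_one_mulVec_mem_of_mapGL_eq hfix hx
  rw [latticeInLevel_iff_of_eq_smul hϖ0 hz1 (by rw [hzsub]; exact hℓ) hTT M, latticeInLevel_iff_of_eq_smul hϖ0 hz1 (by rw [hzsub]; exact hℓ') hTT M,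
    latticeInLevel_sq_iff_of_eq_smul hϖ0 hϖ1 hz1 (by rw [hzsub]; exact hmc) hTT M hAM]

/-! ## §4  Heads -/

section Heads

variable {σ : K →+* K} {ϖ : K} {α β : K} {N₀ n₁ n₂ n₃ : ℕ} {T : GL (Fin 3) K}

/-- `|α| = 1` for an element of `E¹` (`ασα = 1`, `σ` isometric). [cite: Rogawski1990, §4.9 p. 55] -/
theorem v_eq_one_of_mul_map_eq_one (hvσ : ∀ a, Valued.v (σ a) = Valued.v a) (hα : α * σ α = 1) : Valued.v α = 1 := by
  have h : Valued.v α * Valued.v α = 1 := by nth_rw 2 [← hvσ α]; rw [← map_mul, hα, map_one]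
  rw [← pow_two] at h
  exact ((pow_eq_one_iff).1 h).resolve_right two_ne_zero

/-- **HEAD — THE COMMON-SHAPE SUM UNDER `(0 2)` AND THE HOMOTHETY `α⁻¹`** (ANY axis vector, any type `tv`).  At an element datum `(α, β; n₁, n₂, n₃)` (threshold `N₀`, `T = diag(α,β,1)`)
over a ramified quadratic datum, with levels `ℓ, ℓ′ ≤ N₀`, square level `mc ≤ N₀` and label level `m ≤ N₀`, and ANY `T″` with matrix `diag(α⁻¹, βα⁻¹, 1)`:
`Σᶠ_{M ∈ stratum(T,(a₀,a₁,a₂)) ∩ shell(α,β)} m^{Λ(α−1,β−1)}_i(M) ∕ [𝒰 : N(S̃ M)] = Σᶠ_{M ∈ stratum(T″,(a₂,a₁,a₀)) ∩ shell(α⁻¹,βα⁻¹)} m^{Λ(α⁻¹−1,βα⁻¹−1)}_{(0 2) i}(M) ∕ [𝒰 : N(S̃ M)]`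
(★ p861439 `…_perm` at `π = (0 2)`, §3, §2 with §1). [cite: Kottwitz1986BaseChangeUnits, §1 pp. 240–241] [cite: Rogawski1990, §4.9 Prop. 4.9.1 (a)(b) p. 55, Lemma 4.9.3]
[cite: BruhatTits1972, §10] [cite: LanglandsShelstad1987, §3] -/
theorem finsum_stratum_shell_labelledOdd_div_relIndex_swap02 {d t : ℕ} (hD : IsRamifiedQuadraticDatum σ ϖ d t) (hE : IsElementDatum σ ϖ N₀ α β n₁ n₂ n₃)
    (hT : (T : Matrix (Fin 3) (Fin 3) K) = Matrix.diagonal ![α, β, 1]) (T'' : GL (Fin 3) K)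
    (hT'' : (T'' : Matrix (Fin 3) (Fin 3) K) = Matrix.diagonal ![α⁻¹, β * α⁻¹, 1]) (tv a₀ a₁ a₂ : ℕ) {ℓ ℓ' mc m : ℕ}
    (hℓ : ℓ ≤ N₀) (hℓ' : ℓ' ≤ N₀) (hmc : mc ≤ N₀) (hm : m ≤ N₀) (i : Fin 3) :
    ∑ᶠ M ∈ {M : Submodule 𝒪[K] (Fin 3 → K) | M ∈ stratum σ ϖ T ![a₀, a₁, a₂] ∧
        (LatticeInLevel ϖ ℓ (Matrix.diagonal ![α - 1, β - 1, 0]) M ∧ ¬ LatticeInLevel ϖ ℓ' (Matrix.diagonal ![α - 1, β - 1, 0]) M ∧ LatticeInLevel ϖ mc (Matrix.diagonal ![(α - 1) * (α - 1), (β - 1) * (β - 1), 0]) M)},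
      (labelledOddCount σ ϖ tv i (valueClassLabel σ ϖ (α - 1) (β - 1) m d) M : ℚ) / ((((unitStabilizer M).map (unitNormMap σ 3)).relIndex (fixedUnitTorus σ 3) : ℕ) : ℚ) =
    ∑ᶠ M ∈ {M : Submodule 𝒪[K] (Fin 3 → K) | M ∈ stratum σ ϖ T'' ![a₂, a₁, a₀] ∧
        (LatticeInLevel ϖ ℓ (Matrix.diagonal ![α⁻¹ - 1, β * α⁻¹ - 1, 0]) M ∧ ¬ LatticeInLevel ϖ ℓ' (Matrix.diagonal ![α⁻¹ - 1, β * α⁻¹ - 1, 0]) M ∧ LatticeInLevel ϖ mc (Matrix.diagonal ![(α⁻¹ - 1) * (α⁻¹ - 1), (β * α⁻¹ - 1) * (β * α⁻¹ - 1), 0]) M)},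
      (labelledOddCount σ ϖ tv (Equiv.swap (0 : Fin 3) 2 i) (valueClassLabel σ ϖ (α⁻¹ - 1) (β * α⁻¹ - 1) m d) M : ℚ) / ((((unitStabilizer M).map (unitNormMap σ 3)).relIndex (fixedUnitTorus σ 3) : ℕ) : ℚ) := by
  obtain ⟨_, hvσ, hϖ, _, hdd, _, _⟩ := hD
  have hϖ0 : ϖ ≠ 0 := (Valuation.ne_zero_iff Valued.v).1 (by rw [hϖ]; exact WithZero.exp_ne_zero)
  have hϖ1 : Valued.v ϖ ≤ 1 := by rw [hϖ, ← WithZero.exp_zero, WithZero.exp_le_exp]; norm_num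
  have hα : Valued.v α = 1 := v_eq_one_of_mul_map_eq_one hvσ hE.1
  have hα0 : α ≠ 0 := fun h => by rw [h, map_zero] at hα; exact zero_ne_one hα
  have hα1 : Valued.v (α - 1) = Valued.v ϖ ^ n₂ := hE.2.2.2.2.2.2.1
  have hN₂ : N₀ ≤ n₂ := hE.2.2.2.2.2.2.2.2.2.1
  have hpow : ∀ {k : ℕ}, k ≤ N₀ → Valued.v (α - 1) ≤ Valued.v ϖ ^ k := fun hk => by rw [hα1]; exact pow_le_pow_right_of_le_one' hϖ1 (hk.trans hN₂)
  have htp : Valued.v ((ϖ - σ ϖ) * ((ϖ * σ ϖ) ^ ((d - d % 2) / 2))⁻¹) ≤ 1 := by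
    rw [v_refSkewScalar hvσ hϖ hdd, ← WithZero.exp_zero, WithZero.exp_le_exp]; omega
  obtain ⟨P, hP⟩ := exists_gl_coe_eq_permMatrix (K := K) (Equiv.swap (0 : Fin 3) 2)
  rw [finsum_stratum_shell_labelledOdd_div_relIndex_perm σ ϖ P hP T _ tv i _ ℓ ℓ' mc]
  have ha : (![a₀, a₁, a₂] : Fin 3 → ℕ) ∘ ⇑(Equiv.swap (0 : Fin 3) 2).symm = ![a₂, a₁, a₀] := by ext j; fin_cases j <;> rfl
  have he : (![α - 1, β - 1, 0] : Fin 3 → K) ∘ ⇑(Equiv.swap (0 : Fin 3) 2).symm = ![0, β - 1, α - 1] := by ext j; fin_cases j <;> rfl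
  have hf : (![(α - 1) * (α - 1), (β - 1) * (β - 1), 0] : Fin 3 → K) ∘ ⇑(Equiv.swap (0 : Fin 3) 2).symm = ![0 * 0, (β - 1) * (β - 1), (α - 1) * (α - 1)] := by
    ext j; fin_cases j <;> first | rfl | simp
  have hd' : (![α, β, 1] : Fin 3 → K) ∘ ⇑(Equiv.swap (0 : Fin 3) 2).symm = ![1, β, α] := by ext j; fin_cases j <;> rfl
  have hT' : ((P⁻¹ * T * P : GL (Fin 3) K) : Matrix (Fin 3) (Fin 3) K) = Matrix.diagonal ![1, β, α] := by rw [coe_conj_eq_diagonal P hP T hT, hd']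
  rw [ha, he, hf, setOf_stratum_shell_swap02_eq σ hϖ0 hϖ1 hα β (hpow hℓ) (hpow hℓ') (hpow hmc) (P⁻¹ * T * P) T'' hT' hT'' ![a₂, a₁, a₀],
    show ((0 : K) * 0) = 0 from mul_zero 0]
  refine finsum_mem_congr rfl fun M hM => ?_
  rw [labelledOddCount_congr σ ϖ tv (Equiv.swap (0 : Fin 3) 2 i) (Λ' := valueClassLabel σ ϖ (α⁻¹ - 1) (β * α⁻¹ - 1) m d) (fun C hC D hDC =>
    valueClassLabel_mapGL_swap02_iff hvσ hϖ0 htp hα (by rw [map_pow]; exact hpow hm) β P hP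
      (fun y hy => v_gram_le_one_of_mem_polarisationNormClasses hvσ hC hDC hy))]

/-- **ADAPTER `(a,b,c) ↦ (c,b,a)` OVER AN ELEMENT DATUM — THE `(0 2)`-TWIN ROW BY APPLICATION.**  Suppose that at every element datum `(α′, β′; n₁′, n₂′, n₃′)` (threshold `N₀`) over
the place datum, `T′ = diag(α′, β′, 1)`, and every auxiliary witness `w` satisfying `Hyp α′ β′ n₁′ n₂′ n₃′ w`, the common-shape sum over `stratum(T′, (a,b,c))` cut by the shell of
`diag(α′−1, β′−1, 0)` (levels `ℓ`, `¬ℓ′`; squares at `mc`; all `≤ N₀`) with label `valueClassLabel σ ϖ (α′−1) (β′−1) m d` (`m ≤ N₀`) equals `F α′ β′ n₁′ n₂′ n₃′ w i` in slot `i`.  Then at a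
datum `(α, β; n₁, n₂, n₃)` whose RESCALED letters satisfy `Hyp α⁻¹ (βα⁻¹) n₃ n₂ n₁ w`, the same sum over `stratum(T, (c,b,a))` equals `F α⁻¹ (βα⁻¹) n₃ n₂ n₁ w ((0 2) i)` (★
`isElementDatum_rescale`, ★ `exists_gl_rescale_swap02` and the head). [cite: Kottwitz1986BaseChangeUnits, §1 pp. 240–241] [cite: Rogawski1990, §4.9 Prop. 4.9.1 (a)(b) p. 55]
[cite: LanglandsShelstad1987, §3] -/
theorem finsum_stratum_shell_labelledOdd_div_relIndex_swap02_of {d t : ℕ} (hD : IsRamifiedQuadraticDatum σ ϖ d t) (hE : IsElementDatum σ ϖ N₀ α β n₁ n₂ n₃)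
    (hT : (T : Matrix (Fin 3) (Fin 3) K) = Matrix.diagonal ![α, β, 1]) (tv a b c : ℕ) {ℓ ℓ' mc m : ℕ}
    (hℓ : ℓ ≤ N₀) (hℓ' : ℓ' ≤ N₀) (hmc : mc ≤ N₀) (hm : m ≤ N₀) {W : Type*}
    (Hyp : K → K → ℕ → ℕ → ℕ → W → Prop) (F : K → K → ℕ → ℕ → ℕ → W → Fin 3 → ℚ)
    (hG : ∀ {α' β' : K} {n₁' n₂' n₃' : ℕ} (T' : GL (Fin 3) K) (w : W), IsElementDatum σ ϖ N₀ α' β' n₁' n₂' n₃' →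
      (T' : Matrix (Fin 3) (Fin 3) K) = Matrix.diagonal ![α', β', 1] → Hyp α' β' n₁' n₂' n₃' w →
        ∀ i : Fin 3, ∑ᶠ M ∈ {M : Submodule 𝒪[K] (Fin 3 → K) | M ∈ stratum σ ϖ T' ![a, b, c] ∧
            (LatticeInLevel ϖ ℓ (Matrix.diagonal ![α' - 1, β' - 1, 0]) M ∧ ¬ LatticeInLevel ϖ ℓ' (Matrix.diagonal ![α' - 1, β' - 1, 0]) M ∧ LatticeInLevel ϖ mc (Matrix.diagonal ![(α' - 1) * (α' - 1), (β' - 1) * (β' - 1), 0]) M)},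
          (labelledOddCount σ ϖ tv i (valueClassLabel σ ϖ (α' - 1) (β' - 1) m d) M : ℚ) / ((((unitStabilizer M).map (unitNormMap σ 3)).relIndex (fixedUnitTorus σ 3) : ℕ) : ℚ) = F α' β' n₁' n₂' n₃' w i)
    (w : W) (hHyp : Hyp α⁻¹ (β * α⁻¹) n₃ n₂ n₁ w) (i : Fin 3) :
    ∑ᶠ M ∈ {M : Submodule 𝒪[K] (Fin 3 → K) | M ∈ stratum σ ϖ T ![c, b, a] ∧
        (LatticeInLevel ϖ ℓ (Matrix.diagonal ![α - 1, β - 1, 0]) M ∧ ¬ LatticeInLevel ϖ ℓ' (Matrix.diagonal ![α - 1, β - 1, 0]) M ∧ LatticeInLevel ϖ mc (Matrix.diagonal ![(α - 1) * (α - 1), (β - 1) * (β - 1), 0]) M)},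
      (labelledOddCount σ ϖ tv i (valueClassLabel σ ϖ (α - 1) (β - 1) m d) M : ℚ) / ((((unitStabilizer M).map (unitNormMap σ 3)).relIndex (fixedUnitTorus σ 3) : ℕ) : ℚ) = F α⁻¹ (β * α⁻¹) n₃ n₂ n₁ w (Equiv.swap (0 : Fin 3) 2 i) := by
  have hvσ : ∀ a, Valued.v (σ a) = Valued.v a := hD.2.1
  obtain ⟨P, hP⟩ := exists_gl_coe_eq_permMatrix (K := K) (Equiv.swap (0 : Fin 3) 2)
  obtain ⟨T'', hT'', -⟩ := exists_gl_rescale_swap02 hE hT P hP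
  rw [finsum_stratum_shell_labelledOdd_div_relIndex_swap02 hD hE hT T'' hT'' tv c b a hℓ hℓ' hmc hm i]
  exact hG _ w (isElementDatum_rescale hvσ hE) hT'' hHyp _

/-! ### The rows of the record: `ℓ = d % 2`, `ℓ′ = d % 2 + 1`, `mc = mcOfRecord d`, `m* = mstarOfRecord d`, `N₀ = n0DerivedOfRecord d`, type `0` -/

/-- The record's levels lie below the threshold: `d % 2 + 1 ≤ m* ≤ mc ≤ N₀` (`1 ≤ d`). [cite: Rogawski1990, §4.9 p. 55] -/
theorem levels_le_n0DerivedOfRecord {d : ℕ} (hd : 1 ≤ d) :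
    d % 2 ≤ n0DerivedOfRecord d ∧ d % 2 + 1 ≤ n0DerivedOfRecord d ∧ mcOfRecord d ≤ n0DerivedOfRecord d ∧ mstarOfRecord d ≤ n0DerivedOfRecord d := by
  have h1 := mcOfRecord_le_n0DerivedOfRecord d
  have h2 := mstarOfRecord_le_mcOfRecord d
  have h3 : d % 2 + 1 ≤ mstarOfRecord d := by unfold mstarOfRecord; omega
  omega

/-- **EVERY G₃ ROW IS THE G₁ ROW AT THE RESCALED DATUM** (record letters): at `(α, β; n₁, n₂, n₃)`,
`Σᶠ_{M ∈ stratum(T,(2ρ+s,2ρ+s,2ρ)) ∩ clean shell} m^Λ_i(M) ∕ idx = Σᶠ_{M ∈ stratum(T″,(2ρ,2ρ+s,2ρ+s)) ∩ clean shell″} m^{Λ″}_{(0 2) i}(M) ∕ idx` for any `T″` with matrix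
`diag(α⁻¹, βα⁻¹, 1)` — the datum `(α⁻¹, βα⁻¹; n₃, n₂, n₁)` (★ `isElementDatum_rescale`): the tower-3 foot `n₃ = n₂ + s` is the tower-1 foot `n₁″ = n₂″ + s`, the κ-locus
`2ρ + d % 2 = n₂` is unchanged. [cite: Kottwitz1986BaseChangeUnits, §1 pp. 240–241] [cite: Rogawski1990, §4.9 Prop. 4.9.1 (a)(b) p. 55] -/
theorem finsum_stratum_G3_shell_labelledOdd_div_relIndex_eq_of_G1 {d t : ℕ} (hD : IsRamifiedQuadraticDatum σ ϖ d t)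
    (hE : IsElementDatum σ ϖ (n0DerivedOfRecord d) α β n₁ n₂ n₃) (hT : (T : Matrix (Fin 3) (Fin 3) K) = Matrix.diagonal ![α, β, 1]) (T'' : GL (Fin 3) K)
    (hT'' : (T'' : Matrix (Fin 3) (Fin 3) K) = Matrix.diagonal ![α⁻¹, β * α⁻¹, 1]) (ρ s : ℕ) (i : Fin 3) :
    ∑ᶠ M ∈ {M : Submodule 𝒪[K] (Fin 3 → K) | M ∈ stratum σ ϖ T ![2 * ρ + s, 2 * ρ + s, 2 * ρ] ∧
        (LatticeInLevel ϖ (d % 2) (Matrix.diagonal ![α - 1, β - 1, 0]) M ∧ ¬ LatticeInLevel ϖ (d % 2 + 1) (Matrix.diagonal ![α - 1, β - 1, 0]) M ∧ LatticeInLevel ϖ (mcOfRecord d) (Matrix.diagonal ![(α - 1) * (α - 1), (β - 1) * (β - 1), 0]) M)},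
      (labelledOddCount σ ϖ 0 i (valueClassLabel σ ϖ (α - 1) (β - 1) (mstarOfRecord d) d) M : ℚ) / ((((unitStabilizer M).map (unitNormMap σ 3)).relIndex (fixedUnitTorus σ 3) : ℕ) : ℚ) =
    ∑ᶠ M ∈ {M : Submodule 𝒪[K] (Fin 3 → K) | M ∈ stratum σ ϖ T'' ![2 * ρ, 2 * ρ + s, 2 * ρ + s] ∧
        (LatticeInLevel ϖ (d % 2) (Matrix.diagonal ![α⁻¹ - 1, β * α⁻¹ - 1, 0]) M ∧ ¬ LatticeInLevel ϖ (d % 2 + 1) (Matrix.diagonal ![α⁻¹ - 1, β * α⁻¹ - 1, 0]) M ∧ LatticeInLevel ϖ (mcOfRecord d) (Matrix.diagonal ![(α⁻¹ - 1) * (α⁻¹ - 1), (β * α⁻¹ - 1) * (β * α⁻¹ - 1), 0]) M)},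
      (labelledOddCount σ ϖ 0 (Equiv.swap (0 : Fin 3) 2 i) (valueClassLabel σ ϖ (α⁻¹ - 1) (β * α⁻¹ - 1) (mstarOfRecord d) d) M : ℚ) / ((((unitStabilizer M).map (unitNormMap σ 3)).relIndex (fixedUnitTorus σ 3) : ℕ) : ℚ) := by
  obtain ⟨h0, h1, hmc, hm⟩ := levels_le_n0DerivedOfRecord hD.2.2.2.2.2.1
  exact finsum_stratum_shell_labelledOdd_div_relIndex_swap02 hD hE hT T'' hT'' 0 (2 * ρ + s) (2 * ρ + s) (2 * ρ) h0 h1 hmc hm i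

/-- **THE TOWER-3 FOOT LINE FROM THE TOWER-1 FOOT LINE** — the β-table chair's binder `hF₃` of `restSum_eq_of_rows` VERBATIM, from the tower-1 foot line quantified over the element
datum (`hF₁`: at every `(α′, β′; n₁′, n₂′, n₃′)` with `n₁′ = n₂′ + s`, the clean-shell labelled-odd sum over `stratum(T′, (2ρ, 2ρ+s, 2ρ+s))` vanishes in every slot — LH7-p05 (g0)'s
tube∕top∕window theorems are so quantified).  At `(α, β; n₁, n₂, n₃)` with `n₃ = n₂ + s` the rescaled datum `(α⁻¹, βα⁻¹; n₃, n₂, n₁)` is on the tower-1 foot.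
[cite: Kottwitz1986BaseChangeUnits, §1 pp. 240–241] [cite: Rogawski1990, §4.9 Prop. 4.9.1 (a)(b) p. 55, Lemma 4.9.3] [cite: LanglandsShelstad1987, §3] -/
theorem finsum_stratum_G3_shell_labelledOdd_div_relIndex_eq_zero_of_foot_of_G1 {d t : ℕ} (hD : IsRamifiedQuadraticDatum σ ϖ d t)
    (hE : IsElementDatum σ ϖ (n0DerivedOfRecord d) α β n₁ n₂ n₃) (hT : (T : Matrix (Fin 3) (Fin 3) K) = Matrix.diagonal ![α, β, 1])
    (hF₁ : ∀ {α' β' : K} {n₁' n₂' n₃' : ℕ} (T' : GL (Fin 3) K), IsElementDatum σ ϖ (n0DerivedOfRecord d) α' β' n₁' n₂' n₃' →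
      (T' : Matrix (Fin 3) (Fin 3) K) = Matrix.diagonal ![α', β', 1] →
        ∀ (ρ s : ℕ), 1 ≤ ρ → 1 ≤ s → 2 ∣ s → n₁' = n₂' + s → ∀ i : Fin 3,
          ∑ᶠ M ∈ {M : Submodule 𝒪[K] (Fin 3 → K) | M ∈ stratum σ ϖ T' ![2 * ρ, 2 * ρ + s, 2 * ρ + s] ∧
              (LatticeInLevel ϖ (d % 2) (Matrix.diagonal ![α' - 1, β' - 1, 0]) M ∧ ¬ LatticeInLevel ϖ (d % 2 + 1) (Matrix.diagonal ![α' - 1, β' - 1, 0]) M ∧ LatticeInLevel ϖ (mcOfRecord d) (Matrix.diagonal ![(α' - 1) * (α' - 1), (β' - 1) * (β' - 1), 0]) M)},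
            (labelledOddCount σ ϖ 0 i (valueClassLabel σ ϖ (α' - 1) (β' - 1) (mstarOfRecord d) d) M : ℚ) / ((((unitStabilizer M).map (unitNormMap σ 3)).relIndex (fixedUnitTorus σ 3) : ℕ) : ℚ) = 0) :
    ∀ (ρ s : ℕ), 1 ≤ ρ → 1 ≤ s → 2 ∣ s → n₃ = n₂ + s → ∀ i : Fin 3,
      ∑ᶠ M ∈ {M : Submodule 𝒪[K] (Fin 3 → K) | M ∈ stratum σ ϖ T ![2 * ρ + s, 2 * ρ + s, 2 * ρ] ∧
          (LatticeInLevel ϖ (d % 2) (Matrix.diagonal ![α - 1, β - 1, 0]) M ∧ ¬ LatticeInLevel ϖ (d % 2 + 1) (Matrix.diagonal ![α - 1, β - 1, 0]) M ∧ LatticeInLevel ϖ (mcOfRecord d) (Matrix.diagonal ![(α - 1) * (α - 1), (β - 1) * (β - 1), 0]) M)},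
        (labelledOddCount σ ϖ 0 i (valueClassLabel σ ϖ (α - 1) (β - 1) (mstarOfRecord d) d) M : ℚ) / ((((unitStabilizer M).map (unitNormMap σ 3)).relIndex (fixedUnitTorus σ 3) : ℕ) : ℚ) = 0 := by
  intro ρ s hρ hs h2s hfoot i
  have hvσ : ∀ a, Valued.v (σ a) = Valued.v a := hD.2.1
  obtain ⟨P, hP⟩ := exists_gl_coe_eq_permMatrix (K := K) (Equiv.swap (0 : Fin 3) 2)
  obtain ⟨T'', hT'', -⟩ := exists_gl_rescale_swap02 hE hT P hP
  rw [finsum_stratum_G3_shell_labelledOdd_div_relIndex_eq_of_G1 hD hE hT T'' hT'' ρ s i]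
  exact hF₁ T'' (isElementDatum_rescale hvσ hE) hT'' ρ s hρ hs h2s hfoot _

end Heads

end Summit.HodgeConjecture.HodgeConjecture.Cruxes.H413.F0P3cDyRamLabelledOddTowerThreeOfTowerOne

end
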